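import Literature.Barriers.RiemannHypothesis.EpsteinZetaRealZerosDHEvenTwist
import HarnessLib

/-!
# Davenport–Heilbronn for Epstein zeta functions, VIII: conjugate primes of a quadratic field and
# the symmetry `M(s, χ̄) = M(s, χ)` of the norm-twisted class-character series

Sibling of `Literature/Barriers/RiemannHypothesis/EpsteinZetaRealZeros.lean` (named fact
`DavenportHeilbronn1936b_epstein`). Everything in this file is PROVED; no definitions, no named facts.

Davenport–Heilbronn II, §2: in the quadratic field `P(√d)` the primes `π` with `(d/π) = 1` "are
products of two different conjugate prime ideals", whence for a twist `a(p)` depending only on the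
rational prime `p` the twisted class-character series
`M(s, χ) = ∏_𝔭 (1 − χ(𝔭) a(N𝔭) N𝔭^{-s})⁻¹` satisfies
`∏_{p = 𝔭₁𝔭₂} {1 − χ(𝔭₁) a(p) p^{-s}}⁻¹ {1 − χ(𝔭₂) a(p) p^{-s}}⁻¹` with `χ(𝔭₂) = χ̄(𝔭₁)` — so that
`M(s, χ)` depends on `χ` only through `ℜχ` ("`χ(p)` denotes either of the two conjugate complex
numbers `χ(𝔭₁)`, `χ(𝔭₂)`"; formula (1): `F(s) = ∏(1 − p^{-s})^{-2} + 2 Σ_ν ℜχ_ν(𝔎) ∏ {1 − 2ℜχ_ν(p)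
p^{-s} + p^{-2s}}⁻¹`). We prove this symmetry for an arbitrary quadratic field `K` (`[K:ℚ] = 2`):

* `eq_of_ne_of_absNorm_eq` — a prime `𝔭` has at most one *conjugate* `𝔭' ≠ 𝔭` of the same norm;
* `primeClass_mul_self_eq_one_of_forall_eq` — if `𝔭` is the only prime of prime norm `p` then
  `𝔭² = (p)`, so `[𝔭]² = 1` (the ramified primes);
* `logEuler_twistCoeff_neg` — **`E_{χ̄}(s) = E_χ(s)`** for `E_χ(s) = Σ_𝔭 −log(1 − χ([𝔭]) a(N𝔭) N𝔭^{-s})`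
  and every `a : ℕ → ℂ`: the conjugation `𝔭 ↦ 𝔭'` (the other prime of the same norm if there is
  one, else `𝔭`) is an involution of the primes with `[𝔭'] = [𝔭]⁻¹` and `N𝔭' = N𝔭`.

## References

* [DavenportHeilbronn1936b] H. Davenport, H. Heilbronn, *On the zeros of certain Dirichlet
  series II*, J. London Math. Soc. 11 (1936), 307–312, §2 (the decomposition law and formula (1)).
-/

noncomputable section

open Complex NumberField IsDedekindDomain Module
open Literature.NumberTheory.LFunctions Literature.NumberTheory.LFunctions.AbelianDensity
open scoped nonZeroDivisors Classical

namespace Literature.Barriers.RiemannHypothesis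

namespace DHEpstein

variable {K : Type*} [Field K] [NumberField K]

/-! ## Conjugate primes -/

/-- A prime of norm `p²` (`p` the prime below it) is the only prime of its norm: it is `(p)`, and
so is any other prime of norm `p²`. [folklore] -/
theorem eq_of_absNorm_eq_sq (h2 : finrank ℚ K = 2) {v w : HeightOneSpectrum (𝓞 K)}
    (hv : Ideal.absNorm v.asIdeal = underPrime K v ^ 2)
    (hw : Ideal.absNorm w.asIdeal = Ideal.absNorm v.asIdeal) : w = v := by
  have hpv := underPrime_prime K v
  have hpw := underPrime_prime K w
  -- `N w = q` or `q²`, `q` the prime below `w`; the first is impossible (`p²` is not prime)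
  rcases absNorm_eq_or_eq_sq h2 w with h | h
  · exfalso
    rw [hw, hv] at h
    have hprime : (underPrime K v ^ 2).Prime := h ▸ hpw
    have h21 := (hprime.pow_eq_iff.mp rfl).2
    omega
  · have hq : underPrime K w = underPrime K v := by
      have : underPrime K w ^ 2 = underPrime K v ^ 2 := by rw [← h, hw, hv]
      exact Nat.pow_left_injective two_ne_zero this
    apply HeightOneSpectrum.ext
    rw [asIdeal_eq_span_of_absNorm_eq_sq h2 h, asIdeal_eq_span_of_absNorm_eq_sq h2 hv, hq]

/-- **A prime has at most one conjugate**: two primes `𝔭₁, 𝔭₂ ≠ 𝔭` of the same norm as `𝔭` are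
equal (if `N𝔭 = p` then `𝔭𝔭₁ = (p) = 𝔭𝔭₂`; `N𝔭 = p²` admits no such prime).
[cite: DavenportHeilbronn1936b, §2] -/
theorem eq_of_ne_of_absNorm_eq (h2 : finrank ℚ K = 2) {v w₁ w₂ : HeightOneSpectrum (𝓞 K)}
    (h₁ : w₁ ≠ v) (h₂ : w₂ ≠ v) (hn₁ : Ideal.absNorm w₁.asIdeal = Ideal.absNorm v.asIdeal)
    (hn₂ : Ideal.absNorm w₂.asIdeal = Ideal.absNorm v.asIdeal) : w₁ = w₂ := by
  rcases absNorm_eq_or_eq_sq h2 v with hv | hv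
  · have hp := underPrime_prime K v
    have e₁ := mul_eq_span_of_absNorm_eq h2 (Ne.symm h₁) hp hv (hn₁.trans hv)
    have e₂ := mul_eq_span_of_absNorm_eq h2 (Ne.symm h₂) hp hv (hn₂.trans hv)
    have : v.asIdeal * w₁.asIdeal = v.asIdeal * w₂.asIdeal := by rw [e₁, e₂]
    exact HeightOneSpectrum.ext (mul_left_cancel₀ v.ne_bot this)
  · exact absurd (eq_of_absNorm_eq_sq h2 hv hn₁) h₁

/-- **A lone prime of prime norm is ramified**: if `𝔭` is the only prime of norm `p` then
`(p) = 𝔭 · 𝔧` with `N𝔧 = p`, every prime factor of `𝔧` has norm `p`, hence is `𝔭`, so `𝔧 = 𝔭`,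
`𝔭² = (p)` and `[𝔭]² = 1`. [folklore] -/
theorem primeClass_mul_self_eq_one_of_forall_eq (h2 : finrank ℚ K = 2) {v : HeightOneSpectrum (𝓞 K)}
    {p : ℕ} (hp : p.Prime) (hv : Ideal.absNorm v.asIdeal = p)
    (huniq : ∀ w : HeightOneSpectrum (𝓞 K), Ideal.absNorm w.asIdeal = p → w = v) :
    primeClass v * primeClass v = 1 := by
  have hpv : underPrime K v = p := underPrime_eq_of_absNorm_prime hp hv
  have hle : Ideal.span {((p : ℕ) : 𝓞 K)} ≤ v.asIdeal := hpv ▸ span_underPrime_le v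
  obtain ⟨J, hJ⟩ := Ideal.dvd_iff_le.2 hle
  have hp0 : (p : ℕ) ≠ 0 := hp.ne_zero
  have hNJ : Ideal.absNorm J = p := by
    have h := congrArg Ideal.absNorm hJ
    rw [IdealNormCount.absNorm_span_natCast, h2, map_mul, hv, sq] at h
    exact (mul_right_injective₀ hp0 h).symm
  have hJtop : J ≠ ⊤ := fun h ↦ hp.ne_one (by rw [← hNJ, h, Ideal.absNorm_top])
  have hJbot : J ≠ ⊥ := fun h ↦ hp0 (by rw [← hNJ, h, Ideal.absNorm_bot])
  obtain ⟨M, hM, hJM⟩ := Ideal.exists_le_maximal J hJtop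
  have hMbot : M ≠ ⊥ := fun h ↦ hJbot (le_bot_iff.1 (h ▸ hJM))
  set w : HeightOneSpectrum (𝓞 K) := ⟨M, hM.isPrime, hMbot⟩ with hw
  have hNM : Ideal.absNorm M = p := by
    have hdvd : Ideal.absNorm M ∣ p := hNJ ▸ Ideal.absNorm_dvd_absNorm_of_le hJM
    rcases (Nat.dvd_prime hp).1 hdvd with h1 | h1
    · exact absurd (Ideal.absNorm_eq_one_iff.1 h1) hM.ne_top
    · exact h1
  have hwv : w = v := huniq w hNM
  have hvM : v.asIdeal = M := by rw [← hwv]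
  -- `𝔭 ∣ 𝔧`, so `𝔧 = 𝔭`
  obtain ⟨J', hJ'⟩ := Ideal.dvd_iff_le.2 (hvM ▸ hJM : J ≤ v.asIdeal)
  have hNJ' : Ideal.absNorm J' = 1 := by
    have h := congrArg Ideal.absNorm hJ'
    rw [map_mul, hNJ, hv] at h
    have : (p : ℕ) * Ideal.absNorm J' = p * 1 := by rw [mul_one]; exact h.symm
    exact mul_left_cancel₀ hp0 this
  rw [Ideal.absNorm_eq_one_iff] at hNJ'
  rw [hNJ', Ideal.mul_top] at hJ'
  -- `(p) = 𝔭²`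
  rw [hJ'] at hJ
  have hcls := congrArg idealClass hJ
  rw [idealClass_span_singleton (by exact_mod_cast hp0), idealClass_mul v.ne_bot v.ne_bot,
    idealClass_asIdeal] at hcls
  exact hcls.symm

/-- **`E_{χ̄}(s) = E_χ(s)`**: for a quadratic field `K`, a character `χ` of `Cl(K)`, any
`a : ℕ → ℂ` and real `s`, `Σ_𝔭 −log(1 − χ̄([𝔭]) a(N𝔭) N𝔭^{-s}) = Σ_𝔭 −log(1 − χ([𝔭]) a(N𝔭) N𝔭^{-s})`
(`χ̄ = −χ` in `AddChar`): reindex by the conjugation involution `𝔭 ↦ 𝔭'`, which has `[𝔭'] = [𝔭]⁻¹`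
(split: `𝔭𝔭' = (p)`; ramified: `𝔭² = (p)`; inert: `[𝔭] = 1`) and `N𝔭' = N𝔭`. This is the
`χ ↔ χ̄` symmetry behind D–H II formula (1). [cite: DavenportHeilbronn1936b, §2 (1)] -/
theorem logEuler_twistCoeff_neg (h2 : finrank ℚ K = 2) (χ : AddChar (Additive (ClassGroup (𝓞 K))) ℂ)
    (a : ℕ → ℂ) (s : ℝ) : logEuler (twistCoeff (-χ) a) s = logEuler (twistCoeff χ a) s := by
  -- the conjugation involution
  set P : HeightOneSpectrum (𝓞 K) → Prop := fun v ↦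
    ∃ w : HeightOneSpectrum (𝓞 K), w ≠ v ∧ Ideal.absNorm w.asIdeal = Ideal.absNorm v.asIdeal with hP
  set ι : HeightOneSpectrum (𝓞 K) → HeightOneSpectrum (𝓞 K) := fun v ↦
    if h : P v then h.choose else v with hι
  have hιP : ∀ v, P v → ι v ≠ v ∧ Ideal.absNorm (ι v).asIdeal = Ideal.absNorm v.asIdeal := by
    intro v h
    simp only [hι, dif_pos h]
    exact h.choose_spec
  have hιnP : ∀ v, ¬ P v → ι v = v := fun v h ↦ by simp only [hι, dif_neg h]
  have hιN : ∀ v, Ideal.absNorm (ι v).asIdeal = Ideal.absNorm v.asIdeal := by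
    intro v
    by_cases h : P v
    · exact (hιP v h).2
    · rw [hιnP v h]
  have hιι : Function.Involutive ι := by
    intro v
    by_cases h : P v
    · obtain ⟨hne, hN⟩ := hιP v h
      have hPw : P (ι v) := ⟨v, hne.symm, hN.symm⟩
      obtain ⟨hne', hN'⟩ := hιP (ι v) hPw
      -- both `ι (ι v)` and `v` are conjugates of `ι v`
      exact eq_of_ne_of_absNorm_eq h2 hne' hne.symm hN' hN.symm
    · rw [hιnP v h, hιnP v h]
  have hιcls : ∀ v, primeClass (ι v) = (primeClass v)⁻¹ := by
    intro v
    by_cases h : P v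
    · obtain ⟨hne, hN⟩ := hιP v h
      rcases absNorm_eq_or_eq_sq h2 v with hv | hv
      · have hp := underPrime_prime K v
        have := primeClass_mul_primeClass_eq_one h2 (Ne.symm hne) hp hv (hN.trans hv)
        exact eq_inv_of_mul_eq_one_right this
      · exact absurd (eq_of_absNorm_eq_sq h2 hv hN) hne
    · rw [hιnP v h]
      rcases absNorm_eq_or_eq_sq h2 v with hv | hv
      · have hp := underPrime_prime K v
        have huniq : ∀ w : HeightOneSpectrum (𝓞 K), Ideal.absNorm w.asIdeal = underPrime K v → w = v := by
          intro w hw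
          by_contra hwv
          exact h ⟨w, hwv, hw.trans hv.symm⟩
        exact eq_inv_of_mul_eq_one_right (primeClass_mul_self_eq_one_of_forall_eq h2 hp hv huniq)
      · rw [primeClass_eq_one_of_absNorm_eq_sq h2 hv, inv_one]
  -- termwise identity and reindexing
  have hterm : ∀ v, logEulerTerm (twistCoeff (-χ) a) s v = logEulerTerm (twistCoeff χ a) s (ι v) := by
    intro v
    unfold logEulerTerm zterm twistCoeff npow
    rw [hιN v, hιcls v, map_inv, toMulHom_apply, toMulHom_apply, AddChar.neg_apply']
  unfold logEuler
  rw [show (fun v ↦ logEulerTerm (twistCoeff (-χ) a) s v) =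
      fun v ↦ logEulerTerm (twistCoeff χ a) s (ι v) from funext hterm]
  exact (Equiv.ofBijective ι hιι.bijective).tsum_eq (fun v ↦ logEulerTerm (twistCoeff χ a) s v)

/-- **`M(s, χ̄) = M(s, χ)`** for the twisted class-character Euler products `M = exp E` of a
quadratic field. [cite: DavenportHeilbronn1936b, §2 (1)] -/
theorem cexp_logEuler_twistCoeff_neg (h2 : finrank ℚ K = 2)
    (χ : AddChar (Additive (ClassGroup (𝓞 K))) ℂ) (a : ℕ → ℂ) (s : ℝ) :
    cexp (logEuler (twistCoeff (-χ) a) s) = cexp (logEuler (twistCoeff χ a) s) := by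
  rw [logEuler_twistCoeff_neg h2]

end DHEpstein

end Literature.Barriers.RiemannHypothesis
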